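import Mathlib
import Literature.NumberTheory.Irrationality.BrownZudilin2022.GeneralFamily
import Summits.KontsevichZagierPeriods.Zeta5Search.InvarianceOfConverges
import Summits.KontsevichZagierPeriods.Zeta5Search.Families.IntegrabilityApplications
import HarnessLib

/-!
# ζ(5) search — the two superseded PRODUCT-normalised transcriptions of Brown–Zudilin's (27) are FALSE (cell `pub-zeta5`, seat ct-1 g16)

HONEST FRAMING: systematic search; no irrationality claim unless kernel-certified. Nothing in this file is an irrationality
result, a worthiness exponent or a denominator statement; nothing about ζ(5). It settles, by kernel theorems, the status of
two Literature declarations that their own docstrings mark "MIS-STATED — do not use as a hypothesis … (very plausibly, pending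
a Lean proof) FALSE as a Lean proposition" (`Literature/NumberTheory/Irrationality/BrownZudilin2022/GeneralFamily.lean`):

* `BrownZudilin2022.invariance` — (27) transcribed with the PRODUCT normalisation `I(a)·∏_{i∈F} h_i(a)!` and with only
  `Converges a` as guard;
* `BrownZudilin2022.invariance_of_converges` — the first correction (both sides guarded by convergence) which still
  carries the product normalisation.

Both are refuted here: `not_invariance : ¬ invariance`, `not_invariance_of_converges : ¬ invariance_of_converges`.
The CORRECT transcription (quotient normalisation `I(a)/∏_{i∈F} h_i(a)!`, both sides convergent) is
`invariance_of_converges'`, a tree THEOREM since ct-1 g13 (`InvarianceOfConverges.invariance_of_converges'_holds`,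
[BrownZudilin2022, Sect. 7, eq. (27)]), extended to the whole group `G ≅ Σ₇` by ct-1 g15 (`InvarianceGroup.invariance_group_holds`).

## The argument (the lit seat's own witness pair, `GeneralFamily.normalisation_witness`)
At `a = (1,3,2,1,2,1,2,2)` and `p₁₂ a = (1,3,0,3,0,3,2,2)` — BOTH convergent, with `∏_{i∈F} h_i(a)! = 10368` and
`∏_{i∈F} h_i(p₁₂ a)! = 31104 = 3·10368` — the proved (27) gives the printed relation `I(p₁₂ a) = 3·I(a)`
(`invariance_of_converges'.witness`), whereas the `p₁₂`-conjunct of either product-normalised transcription reads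
`I(p₁₂ a)·31104 = I(a)·10368`, i.e. `I(p₁₂ a) = I(a)/3`. Together they force `I(a) = 0`, contradicting `I(a) > 0`
(`Families.Cellular.cellularIntegral_bz_pos`: on the polytope (3) the Brown–Zudilin integral is a positive convergent integral).
No divergence argument is needed (the docstring of `invariance` sketches one through a non-convergent image; the convergent
witness pair refutes both declarations at once).

Theorems only (no new definitions). Standard axioms.
-/

noncomputable section

namespace Summit.KontsevichZagierPeriods.Zeta5Search.InvarianceProductRefutation

open Literature.NumberTheory.Irrationality.BrownZudilin2022
open Summit.KontsevichZagierPeriods.Zeta5Search.InvarianceOfConverges (invariance_of_converges'_holds)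
open Summit.KontsevichZagierPeriods.Zeta5Search.Families.Cellular (cellularIntegral_bz_pos)

/-- The witness parameter vector `a = (1,3,2,1,2,1,2,2)` of `GeneralFamily.normalisation_witness`. -/
theorem converges_witness : Converges ![1, 3, 2, 1, 2, 1, 2, 2] := normalisation_witness.2.1

/-- `I(1,3,2,1,2,1,2,2) > 0` (a positive convergent integral). -/
theorem cellularIntegral_witness_pos : 0 < cellularIntegral ![1, 3, 2, 1, 2, 1, 2, 2] :=
  cellularIntegral_bz_pos _ converges_witness

/-- The printed relation at the witness pair, now UNCONDITIONAL: `I(1,3,0,3,0,3,2,2) = 3·I(1,3,2,1,2,1,2,2)`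
((27) with `g = p₁₂`, display after (28) of [BrownZudilin2022, Sect. 7]; from `invariance_of_converges'_holds`). -/
theorem cellularIntegral_genP12_witness :
    cellularIntegral ![1, 3, 0, 3, 0, 3, 2, 2] = 3 * cellularIntegral ![1, 3, 2, 1, 2, 1, 2, 2] :=
  invariance_of_converges'.witness invariance_of_converges'_holds

/-- The cast of the factorial normaliser: the real product over `F` is the cast of the natural-number product. -/
theorem normaliser_cast (a : Fin 8 → ℤ) :
    ((Fset.map fun i => ((hForm a i).toNat.factorial : ℝ)).prod)
      = (((Fset.map fun i => (hForm a i).toNat.factorial).prod : ℕ) : ℝ) := by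
  rw [Nat.cast_list_prod, List.map_map]; rfl

/-- **The `p₁₂`-conjunct of the product normalisation FAILS at the witness**:
`I(p₁₂ a)·∏_{i∈F} h_i(p₁₂ a)! ≠ I(a)·∏_{i∈F} h_i(a)!` for `a = (1,3,2,1,2,1,2,2)` (it would read `3·I(a)·31104 = I(a)·10368`
with `I(a) > 0`). -/
theorem normalisedIntegral_genP12_witness_ne :
    normalisedIntegral (genP12 ![1, 3, 2, 1, 2, 1, 2, 2]) ≠ normalisedIntegral ![1, 3, 2, 1, 2, 1, 2, 2] := by
  obtain ⟨hg, -, -, hpa, hpg⟩ := normalisation_witness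
  rw [hg]
  unfold normalisedIntegral
  rw [normaliser_cast, normaliser_cast, hpa, hpg, cellularIntegral_genP12_witness]
  have hpos := cellularIntegral_witness_pos
  push_cast
  intro h
  nlinarith

/-- **`BrownZudilin2022.invariance` is FALSE** (the product-normalised, one-sided-guarded transcription of (27); superseded by
`invariance_of_converges'`, which HOLDS). Witness: `a = (1,3,2,1,2,1,2,2)`, generator `p₁₂`. -/
theorem not_invariance : ¬ invariance := fun h =>
  normalisedIntegral_genP12_witness_ne (h _ converges_witness).2.2.1

/-- **`BrownZudilin2022.invariance_of_converges` is FALSE** (the product-normalised transcription of (27) with both sides guarded;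
superseded by `invariance_of_converges'`, which HOLDS). Witness: `a = (1,3,2,1,2,1,2,2)`, generator `p₁₂` (both sides convergent). -/
theorem not_invariance_of_converges : ¬ invariance_of_converges := fun h =>
  normalisedIntegral_genP12_witness_ne
    ((h _ converges_witness).2.2.1 (normalisation_witness.1 ▸ normalisation_witness.2.2.1))

/-- Type probes: the refuted declarations are the Literature ones, verbatim. -/
example : ¬ Literature.NumberTheory.Irrationality.BrownZudilin2022.invariance := not_invariance
example : ¬ Literature.NumberTheory.Irrationality.BrownZudilin2022.invariance_of_converges := not_invariance_of_converges
/-- And the correct transcription holds (tree theorem, ct-1 g13). -/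
example : Literature.NumberTheory.Irrationality.BrownZudilin2022.invariance_of_converges' := invariance_of_converges'_holds

end Summit.KontsevichZagierPeriods.Zeta5Search.InvarianceProductRefutation

end
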